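import Summits.Ventures.HodgeRepro2.T5RecordJointNine
import Summits.Ventures.HodgeRepro2.T5CMFieldCyclicGaloisCriterion

/-!
# Joint consistency on EVERY cyclic Galois CM field — in particular every sextic Galois CM field — at every
unramified prime that stays prime

Tier-5 support N3 / §G-N4.2 (seat p3, gen 88). The brief's case is the SEXTIC Galois CM field; files 358 / 359 / 363 /
365 instantiate the joint statement of file 356 on the record's three examples (`ℚ(ζ₇)`, `ℚ(ζ₉)`,
`F = ℚ(ζ₂₁)^{⟨σ₁₃⟩}`) through their cyclotomic censuses. This file states it ONCE, for every cyclic Galois CM field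
`K` (file 281's criterion: a place of `K⁺` above an unramified `p` stays prime iff `f(P/p)` is even) and hence for
every sextic Galois CM field (file 281: `Gal(K/ℚ)` is cyclic when `[K : ℚ] = 6`), with no cyclotomic presentation:

* **`joint_cyclic_galois_cm_of_even_inertiaDeg`** — `K` CM, Galois over `ℚ` with cyclic Galois group; `p` a prime
  unramified in `K` (`e(w/p) = 1` for every prime `w` of `K` containing `p`); `P ∣ p` in `K` with `f(P/p)` even;
  `v` the place of `K⁺` under `P`: `∃ w, v 𝓞_K = w` and the lattice-model data for `diag(1, 1, −1)` at `v` over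
  `vRat p` AND the unramified spectrum of the record's pair at `v` (Satake parameter `α · N(v)⁻²`);
* **`joint_sextic_galois_cm_of_even_inertiaDeg`** — the same for every sextic Galois CM field (`[K : ℚ] = 6`).

The unramifiedness enters twice: `disc K ∉ v` (file 362) and `e(P/p) = 1` for file 281's criterion. Nothing is
claimed at the ramified primes, and no infinitude is claimed here (Chebotarev is not in the tree; the record's
per-field infinitudes are files 360 / 361 / 364 / 368). §8(d): uses an L-value-free non-vanishing device: NO.
-/
open Matrix NumberField NumberField.IsCMField IsDedekindDomain IsDedekindDomain.HeightOneSpectrum Module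
  MulAction
open scoped TensorProduct Pointwise
open Summit.Ventures.HodgeRepro2.T5UnitaryGroupForm Summit.Ventures.HodgeRepro2.T5UnitaryHeckeAdjoint
  Summit.Ventures.HodgeRepro2.T5HeckePermutationModule Summit.Ventures.HodgeRepro2.LevelPositivity
  Summit.Ventures.HodgeRepro2.T5LevelIdempotent Summit.Ventures.HodgeRepro2.T5StarOfInvolution
  Summit.Ventures.HodgeRepro2.T5FinitePlaceCM Summit.Ventures.HodgeRepro2.T5NonSplitPlaceUnitaryGroup
  Summit.Ventures.HodgeRepro2.T5RecordHyperspecial Summit.Ventures.HodgeRepro2.T5GlobalLatticeAlmostAll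
  Summit.Ventures.HodgeRepro2.T5HermitianThreeElements Summit.Ventures.HodgeRepro2.T5GaloisCartanThree
  Summit.Ventures.HodgeRepro2.T5InertDegreeGalois Summit.Ventures.HodgeRepro2.T5InertPlaceCompletion
  Summit.Ventures.HodgeRepro2.T5InertDegreeAdicCompletion Summit.Ventures.HodgeRepro2.T5InertSatakeTransform
  Summit.Ventures.HodgeRepro2.T5InertSatakeTransformCompletion Summit.Ventures.HodgeRepro2.T5InertUnipotentResidue
  Summit.Ventures.HodgeRepro2.T5InertSphericalSubquotient Summit.Ventures.HodgeRepro2.T5RecordSatakeCell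
  Summit.Ventures.HodgeRepro2.T5SplitPlaceUnitaryGroup Summit.Ventures.HodgeRepro2.T5FinitePlaceNormIndex
  Summit.Ventures.HodgeRepro2.T5HermitianLocalIsotropyN3 Summit.Ventures.HodgeRepro2.T5FinitePlaceSplitClassification
  Summit.Ventures.HodgeRepro2.T5InertDegreeCompletion Summit.Ventures.HodgeRepro2.T5InertPlaceCompletionCells
  Summit.Ventures.HodgeRepro2.T5RecordSatake Summit.Ventures.HodgeRepro2.T5CartanCellsDistinct
  Summit.Ventures.HodgeRepro2.T5RecordSatakeInert Summit.Ventures.HodgeRepro2.T5InertGlobalPrime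
  Summit.Ventures.HodgeRepro2.T5CMFieldSquareDatum Summit.Ventures.HodgeRepro2.T5RecordSatakeDegree
  Summit.Ventures.HodgeRepro2.T5RecordSatakeDegreeIntrinsic Summit.Ventures.HodgeRepro2.T5RecordSphericalSpectrum
  Summit.Ventures.HodgeRepro2.T5RecordSphericalSpectrumIntrinsic Summit.Ventures.HodgeRepro2.T5RecordSatakeToy
  Summit.Ventures.HodgeRepro2.T5RecordSphericalSpectrumDatumFree
  Summit.Ventures.HodgeRepro2.T5AdditiveConductor Summit.Ventures.HodgeRepro2.T5UnitaryGroupIsometry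
  Summit.Ventures.HodgeRepro2.T5ConductorDualLattice Summit.Ventures.HodgeRepro2.T5ConductorDualLatticeSplit
  Summit.Ventures.HodgeRepro2.T5SplitHermitianClass Summit.Ventures.HodgeRepro2.T5RecordLatticeModelOutsideDiscriminant
  Summit.Ventures.HodgeRepro2.T5RecordLatticeModelSeven Summit.Ventures.HodgeRepro2.T5RecordJointOutsideDiscriminant
  Summit.Ventures.HodgeRepro2.T5RationalPlace Summit.Ventures.HodgeRepro2.T5DiscriminantUnramified
  Summit.Ventures.HodgeRepro2.T5CyclotomicSevenHeckeCommutative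
  Summit.Ventures.HodgeRepro2.T5CyclotomicSevenSplitPrime Summit.Ventures.HodgeRepro2.T5RecordJointNine
  Summit.Ventures.HodgeRepro2.T5CMFieldCyclicGaloisCriterion

namespace Summit.Ventures.HodgeRepro2.T5RecordJointCyclicGaloisCM

universe uV

variable (K : Type*) [Field K] [NumberField K] [IsCMField K] [IsGalois ℚ K]
variable (p : ℕ) [hp : Fact p.Prime]
variable (k : Type*) [Field k] [CharZero k] [IsAlgClosed k]

/-- **JOINT CONSISTENCY ON EVERY CYCLIC GALOIS CM FIELD AT EVERY UNRAMIFIED PRIME THAT STAYS PRIME** (file 356 at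
`vp = vRat p`, the place `w` supplied by file 281's criterion): `p` unramified in `K`, `P ∣ p` with `f(P/p)` even, `v`
under `P`. -/
theorem joint_cyclic_galois_cm_of_even_inertiaDeg [IsCyclic (K ≃ₐ[ℚ] K)]
    (hunr : ∀ w : HeightOneSpectrum (𝓞 K), (p : 𝓞 K) ∈ w.asIdeal → w.asIdeal.ramificationIdx ℤ = 1)
    (P : Ideal (𝓞 K)) [P.IsPrime] [P.LiesOver (Ideal.span {(p : ℤ)})]
    (v : HeightOneSpectrum (𝓞 (maximalRealSubfield K))) [P.LiesOver v.asIdeal] (hEven : Even (P.inertiaDeg ℤ)) :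
    letI : v.asIdeal.LiesOver (vRat p).asIdeal := liesOver_vRat_of_mem p v (natCast_mem_of_liesOver_of_liesOver K p P v)
    ∃ (w : HeightOneSpectrum (𝓞 K))
      (hmap : Ideal.map (algebraMap (𝓞 (maximalRealSubfield K)) (𝓞 K)) v.asIdeal = w.asIdeal),
      letI := liesOver_of_map_eq K v w hmap
      ((∃ ψ : AddChar ((vRat p).adicCompletion ℚ) Circle, Continuous ψ ∧ (∃ y, ψ y ≠ 1) ∧
        conductorExp ψ (Valued.v : Valuation ((vRat p).adicCompletion ℚ) (WithZero (Multiplicative ℤ))) = 0 ∧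
        conductorExp (ψ.compAddMonoidHom
          (Algebra.trace ((vRat p).adicCompletion ℚ) (v.adicCompletion (maximalRealSubfield K))).toAddMonoidHom)
          (Valued.v : Valuation (v.adicCompletion (maximalRealSubfield K)) (WithZero (Multiplicative ℤ))) = 0) ∧
      ∀ (ψ : AddChar ((vRat p).adicCompletion ℚ) Circle), Continuous ψ → (∃ y, ψ y ≠ 1) →
        conductorExp ψ (Valued.v : Valuation ((vRat p).adicCompletion ℚ) (WithZero (Multiplicative ℤ))) = 0 →
        ∀ (w' : HeightOneSpectrum (𝓞 K)) [w'.asIdeal.LiesOver v.asIdeal],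
          v.asIdeal.ramificationIdx' w'.asIdeal = 1 ∧
          conductorExp (recordChar K (vRat p) v w' ψ)
            (Valued.v : Valuation (w'.adicCompletion K) (WithZero (Multiplicative ℤ))) = 0 ∧
          (∀ x : w'.adicCompletion K,
            (∀ y : w'.adicCompletion K, Valued.v y ≤ 1 → recordChar K (vRat p) v w' ψ (x * y) = 1) ↔ Valued.v x ≤ 1) ∧
          (∀ [StarRing (w'.adicCompletion K)],
            (∀ z : w'.adicCompletion K, IsLocalization.IsInteger (w'.adicCompletionIntegers K) z →
              IsLocalization.IsInteger (w'.adicCompletionIntegers K) (star z)) →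
            ∀ x : Fin 3 → w'.adicCompletion K,
              (∀ y ∈ stdLattice (w'.adicCompletionIntegers K),
                recordChar K (vRat p) v w' ψ
                  (sesqForm (((algebraMap (𝓞 K) K).mapMatrix (Matrix.diagonal ![1, 1, -1])).map (algebraMap K (w'.adicCompletion K))) x y) = 1) ↔
                x ∈ stdLattice (w'.adicCompletionIntegers K)) ∧
          (letI := swapStarRing (w'.adicCompletion K)
            ∀ x : Fin 3 → w'.adicCompletion K × w'.adicCompletion K,
              (∀ y : Fin 3 → w'.adicCompletion K × w'.adicCompletion K,
                (∀ i, Valued.v (y i).1 ≤ 1 ∧ Valued.v (y i).2 ≤ 1) →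
                recordChar K (vRat p) v w' ψ
                    (sesqForm (pairMatrix (((algebraMap (𝓞 K) K).mapMatrix (Matrix.diagonal ![1, 1, -1])).map (algebraMap K (w'.adicCompletion K)))
                      (((algebraMap (𝓞 K) K).mapMatrix (Matrix.diagonal ![1, 1, -1])).map (algebraMap K (w'.adicCompletion K)))ᵀ) x y).1 *
                  recordChar K (vRat p) v w' ψ
                    (sesqForm (pairMatrix (((algebraMap (𝓞 K) K).mapMatrix (Matrix.diagonal ![1, 1, -1])).map (algebraMap K (w'.adicCompletion K)))
                      (((algebraMap (𝓞 K) K).mapMatrix (Matrix.diagonal ![1, 1, -1])).map (algebraMap K (w'.adicCompletion K)))ᵀ) x y).2 = 1) ↔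
                ∀ i, Valued.v (x i).1 ≤ 1 ∧ Valued.v (x i).2 ≤ 1)) ∧
      (∃ (θ : maximalRealSubfield K) (y : K) (hθ : algebraMap (maximalRealSubfield K) K θ = y ^ 2)
        (hy : complexConj K y ≠ y) (r : ℕ) (l : Fin r → 𝓞 K)
        (_hl : Submodule.span (𝓞 (maximalRealSubfield K)) (Set.range l) = ⊤),
        letI := tensorStarRing K v
        letI := starRingOfQuadratic (finrank_eq_two K v w hθ hy (not_isSquare_of_staysPrime K v w hθ hy hmap))
          (localConj v w hθ.symm (span_pair_eq_top K hy) (not_isSquare_of_staysPrime K v w hθ hy hmap) (complexConj K))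
          (localConj_ne_one v w hθ.symm (span_pair_eq_top K hy) (not_isSquare_of_staysPrime K v w hθ hy hmap)
            (complexConj K) (complexConj_apply_eq_neg K hθ hy))
        haveI := isDiscreteValuationRing_integralClosure_adicCompletion v w
        haveI := finite_residueField_integralClosure_adicCompletion v w
        haveI : IsFractionRing (integralClosure (v.adicCompletionIntegers (maximalRealSubfield K)) (w.adicCompletion K))
          (w.adicCompletion K) :=
          integralClosure.isFractionRing_of_finite_extension (v.adicCompletion (maximalRealSubfield K))
            (w.adicCompletion K)
        ∃ (u₀ : (v.adicCompletionIntegers (maximalRealSubfield K))ˣ)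
          (Φ : ↥(formUnitaryGroup (J3 (algebraMap (v.adicCompletionIntegers (maximalRealSubfield K))
            (w.adicCompletion K) (u₀ : v.adicCompletionIntegers (maximalRealSubfield K))))) ≃*
            ↥(formUnitaryGroup (tensorGram K v (gramToy K))))
          (ϖ' : integralClosure (v.adicCompletionIntegers (maximalRealSubfield K)) (w.adicCompletion K))
          (hϖ' : Irreducible ϖ')
          (hs' : star (algebraMap (integralClosure (v.adicCompletionIntegers (maximalRealSubfield K))
            (w.adicCompletion K)) (w.adicCompletion K) ϖ') =
              algebraMap (integralClosure (v.adicCompletionIntegers (maximalRealSubfield K)) (w.adicCompletion K))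
                (w.adicCompletion K) ϖ'),
          (∀ g, g ∈ hyperspecialSubgroup
              (integralClosure (v.adicCompletionIntegers (maximalRealSubfield K)) (w.adicCompletion K))
              (J3 (algebraMap (v.adicCompletionIntegers (maximalRealSubfield K)) (w.adicCompletion K)
                (u₀ : v.adicCompletionIntegers (maximalRealSubfield K)))) ↔ Φ g ∈ recordHyperspecial K v l (gramToy K)) ∧
          ∀ {V : Type uV} [AddCommGroup V] [Module k V]
            (ρ : Representation k (↥(formUnitaryGroup (tensorGram K v (gramToy K)))) V) [ρ.IsIrreducible],
            KFinite ρ (recordHyperspecial K v l (gramToy K)) →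
            ∀ [FiniteDimensional k (invariants ρ (recordHyperspecial K v l (gramToy K)))],
            invariants ρ (recordHyperspecial K v l (gramToy K)) ≠ ⊥ →
            ∃ α : k, α ≠ 0 ∧ Nonempty (ρ.Equiv (comp Φ.symm
              (inertSphericalQuot
                (hstar_of_star_eq (localConj v w hθ.symm (span_pair_eq_top K hy)
                  (not_isSquare_of_staysPrime K v w hθ hy hmap) (complexConj K))
                  (fun x => by rw [star_p8_eq_star K v w hθ hy (not_isSquare_of_staysPrime K v w hθ hy hmap)]; rfl))
                (algebraMap (v.adicCompletionIntegers (maximalRealSubfield K)) (w.adicCompletion K)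
                  (u₀ : v.adicCompletionIntegers (maximalRealSubfield K)))
                (star_algebraMap_of_star_eq (localConj v w hθ.symm (span_pair_eq_top K hy)
                  (not_isSquare_of_staysPrime K v w hθ hy hmap) (complexConj K))
                  (fun x => by rw [star_p8_eq_star K v w hθ hy (not_isSquare_of_staysPrime K v w hθ hy hmap)]; rfl)
                  (u₀ : v.adicCompletionIntegers (maximalRealSubfield K)))
                (algebraMap_unit_ne_zero (F := v.adicCompletion (maximalRealSubfield K)) u₀)
                (isInteger_algebraMap (u₀ : v.adicCompletionIntegers (maximalRealSubfield K)))
                (isInteger_algebraMap_unit_inv u₀) hϖ' hs' k (α * ((Ideal.absNorm v.asIdeal : k) ^ 2)⁻¹))))) :=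
  have hne : P ≠ ⊥ :=
    Ideal.ne_bot_of_liesOver_of_ne_bot
      ((Ideal.span_singleton_eq_bot).not.mpr (Nat.cast_ne_zero.mpr hp.out.ne_zero) : Ideal.span {(p : ℤ)} ≠ ⊥) P
  have he : P.ramificationIdx ℤ = 1 := hunr ⟨P, inferInstance, hne⟩ (natCast_mem_of_liesOver K p P)
  ((exists_map_eq_iff_even_inertiaDeg K p P v he).mpr hEven).elim fun w hmap =>
    ⟨w, hmap, @joint_outside_discriminant_of_staysPrime K _ _ _ (vRat p) v
      (liesOver_vRat_of_mem p v (natCast_mem_of_liesOver_of_liesOver K p P v))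
      (@discr_notMem_of_forall_ramificationIdx_eq_one K _ _ p _ hunr v
        (liesOver_int_of_mem p v (natCast_mem_of_liesOver_of_liesOver K p P v)))
      w (liesOver_of_map_eq K v w hmap) hmap k _ _ _⟩

/-- **JOINT CONSISTENCY ON EVERY SEXTIC GALOIS CM FIELD AT EVERY UNRAMIFIED PRIME THAT STAYS PRIME** — the brief's
case in general (`Gal(K/ℚ)` is cyclic for `[K : ℚ] = 6`, file 281): `p` unramified in `K`, `P ∣ p` with `f(P/p)` even,
`v` under `P`: `∃ w, v 𝓞_K = w` and the joint statement of file 356 at `v` over `vRat p`. -/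
theorem joint_sextic_galois_cm_of_even_inertiaDeg (h6 : Module.finrank ℚ K = 6)
    (hunr : ∀ w : HeightOneSpectrum (𝓞 K), (p : 𝓞 K) ∈ w.asIdeal → w.asIdeal.ramificationIdx ℤ = 1)
    (P : Ideal (𝓞 K)) [P.IsPrime] [P.LiesOver (Ideal.span {(p : ℤ)})]
    (v : HeightOneSpectrum (𝓞 (maximalRealSubfield K))) [P.LiesOver v.asIdeal] (hEven : Even (P.inertiaDeg ℤ)) :
    letI : v.asIdeal.LiesOver (vRat p).asIdeal := liesOver_vRat_of_mem p v (natCast_mem_of_liesOver_of_liesOver K p P v)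
    ∃ (w : HeightOneSpectrum (𝓞 K))
      (hmap : Ideal.map (algebraMap (𝓞 (maximalRealSubfield K)) (𝓞 K)) v.asIdeal = w.asIdeal),
      letI := liesOver_of_map_eq K v w hmap
      ((∃ ψ : AddChar ((vRat p).adicCompletion ℚ) Circle, Continuous ψ ∧ (∃ y, ψ y ≠ 1) ∧
        conductorExp ψ (Valued.v : Valuation ((vRat p).adicCompletion ℚ) (WithZero (Multiplicative ℤ))) = 0 ∧
        conductorExp (ψ.compAddMonoidHom
          (Algebra.trace ((vRat p).adicCompletion ℚ) (v.adicCompletion (maximalRealSubfield K))).toAddMonoidHom)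
          (Valued.v : Valuation (v.adicCompletion (maximalRealSubfield K)) (WithZero (Multiplicative ℤ))) = 0) ∧
      ∀ (ψ : AddChar ((vRat p).adicCompletion ℚ) Circle), Continuous ψ → (∃ y, ψ y ≠ 1) →
        conductorExp ψ (Valued.v : Valuation ((vRat p).adicCompletion ℚ) (WithZero (Multiplicative ℤ))) = 0 →
        ∀ (w' : HeightOneSpectrum (𝓞 K)) [w'.asIdeal.LiesOver v.asIdeal],
          v.asIdeal.ramificationIdx' w'.asIdeal = 1 ∧
          conductorExp (recordChar K (vRat p) v w' ψ)
            (Valued.v : Valuation (w'.adicCompletion K) (WithZero (Multiplicative ℤ))) = 0 ∧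
          (∀ x : w'.adicCompletion K,
            (∀ y : w'.adicCompletion K, Valued.v y ≤ 1 → recordChar K (vRat p) v w' ψ (x * y) = 1) ↔ Valued.v x ≤ 1) ∧
          (∀ [StarRing (w'.adicCompletion K)],
            (∀ z : w'.adicCompletion K, IsLocalization.IsInteger (w'.adicCompletionIntegers K) z →
              IsLocalization.IsInteger (w'.adicCompletionIntegers K) (star z)) →
            ∀ x : Fin 3 → w'.adicCompletion K,
              (∀ y ∈ stdLattice (w'.adicCompletionIntegers K),
                recordChar K (vRat p) v w' ψ
                  (sesqForm (((algebraMap (𝓞 K) K).mapMatrix (Matrix.diagonal ![1, 1, -1])).map (algebraMap K (w'.adicCompletion K))) x y) = 1) ↔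
                x ∈ stdLattice (w'.adicCompletionIntegers K)) ∧
          (letI := swapStarRing (w'.adicCompletion K)
            ∀ x : Fin 3 → w'.adicCompletion K × w'.adicCompletion K,
              (∀ y : Fin 3 → w'.adicCompletion K × w'.adicCompletion K,
                (∀ i, Valued.v (y i).1 ≤ 1 ∧ Valued.v (y i).2 ≤ 1) →
                recordChar K (vRat p) v w' ψ
                    (sesqForm (pairMatrix (((algebraMap (𝓞 K) K).mapMatrix (Matrix.diagonal ![1, 1, -1])).map (algebraMap K (w'.adicCompletion K)))
                      (((algebraMap (𝓞 K) K).mapMatrix (Matrix.diagonal ![1, 1, -1])).map (algebraMap K (w'.adicCompletion K)))ᵀ) x y).1 *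
                  recordChar K (vRat p) v w' ψ
                    (sesqForm (pairMatrix (((algebraMap (𝓞 K) K).mapMatrix (Matrix.diagonal ![1, 1, -1])).map (algebraMap K (w'.adicCompletion K)))
                      (((algebraMap (𝓞 K) K).mapMatrix (Matrix.diagonal ![1, 1, -1])).map (algebraMap K (w'.adicCompletion K)))ᵀ) x y).2 = 1) ↔
                ∀ i, Valued.v (x i).1 ≤ 1 ∧ Valued.v (x i).2 ≤ 1)) ∧
      (∃ (θ : maximalRealSubfield K) (y : K) (hθ : algebraMap (maximalRealSubfield K) K θ = y ^ 2)
        (hy : complexConj K y ≠ y) (r : ℕ) (l : Fin r → 𝓞 K)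
        (_hl : Submodule.span (𝓞 (maximalRealSubfield K)) (Set.range l) = ⊤),
        letI := tensorStarRing K v
        letI := starRingOfQuadratic (finrank_eq_two K v w hθ hy (not_isSquare_of_staysPrime K v w hθ hy hmap))
          (localConj v w hθ.symm (span_pair_eq_top K hy) (not_isSquare_of_staysPrime K v w hθ hy hmap) (complexConj K))
          (localConj_ne_one v w hθ.symm (span_pair_eq_top K hy) (not_isSquare_of_staysPrime K v w hθ hy hmap)
            (complexConj K) (complexConj_apply_eq_neg K hθ hy))
        haveI := isDiscreteValuationRing_integralClosure_adicCompletion v w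
        haveI := finite_residueField_integralClosure_adicCompletion v w
        haveI : IsFractionRing (integralClosure (v.adicCompletionIntegers (maximalRealSubfield K)) (w.adicCompletion K))
          (w.adicCompletion K) :=
          integralClosure.isFractionRing_of_finite_extension (v.adicCompletion (maximalRealSubfield K))
            (w.adicCompletion K)
        ∃ (u₀ : (v.adicCompletionIntegers (maximalRealSubfield K))ˣ)
          (Φ : ↥(formUnitaryGroup (J3 (algebraMap (v.adicCompletionIntegers (maximalRealSubfield K))
            (w.adicCompletion K) (u₀ : v.adicCompletionIntegers (maximalRealSubfield K))))) ≃*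
            ↥(formUnitaryGroup (tensorGram K v (gramToy K))))
          (ϖ' : integralClosure (v.adicCompletionIntegers (maximalRealSubfield K)) (w.adicCompletion K))
          (hϖ' : Irreducible ϖ')
          (hs' : star (algebraMap (integralClosure (v.adicCompletionIntegers (maximalRealSubfield K))
            (w.adicCompletion K)) (w.adicCompletion K) ϖ') =
              algebraMap (integralClosure (v.adicCompletionIntegers (maximalRealSubfield K)) (w.adicCompletion K))
                (w.adicCompletion K) ϖ'),
          (∀ g, g ∈ hyperspecialSubgroup
              (integralClosure (v.adicCompletionIntegers (maximalRealSubfield K)) (w.adicCompletion K))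
              (J3 (algebraMap (v.adicCompletionIntegers (maximalRealSubfield K)) (w.adicCompletion K)
                (u₀ : v.adicCompletionIntegers (maximalRealSubfield K)))) ↔ Φ g ∈ recordHyperspecial K v l (gramToy K)) ∧
          ∀ {V : Type uV} [AddCommGroup V] [Module k V]
            (ρ : Representation k (↥(formUnitaryGroup (tensorGram K v (gramToy K)))) V) [ρ.IsIrreducible],
            KFinite ρ (recordHyperspecial K v l (gramToy K)) →
            ∀ [FiniteDimensional k (invariants ρ (recordHyperspecial K v l (gramToy K)))],
            invariants ρ (recordHyperspecial K v l (gramToy K)) ≠ ⊥ →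
            ∃ α : k, α ≠ 0 ∧ Nonempty (ρ.Equiv (comp Φ.symm
              (inertSphericalQuot
                (hstar_of_star_eq (localConj v w hθ.symm (span_pair_eq_top K hy)
                  (not_isSquare_of_staysPrime K v w hθ hy hmap) (complexConj K))
                  (fun x => by rw [star_p8_eq_star K v w hθ hy (not_isSquare_of_staysPrime K v w hθ hy hmap)]; rfl))
                (algebraMap (v.adicCompletionIntegers (maximalRealSubfield K)) (w.adicCompletion K)
                  (u₀ : v.adicCompletionIntegers (maximalRealSubfield K)))
                (star_algebraMap_of_star_eq (localConj v w hθ.symm (span_pair_eq_top K hy)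
                  (not_isSquare_of_staysPrime K v w hθ hy hmap) (complexConj K))
                  (fun x => by rw [star_p8_eq_star K v w hθ hy (not_isSquare_of_staysPrime K v w hθ hy hmap)]; rfl)
                  (u₀ : v.adicCompletionIntegers (maximalRealSubfield K)))
                (algebraMap_unit_ne_zero (F := v.adicCompletion (maximalRealSubfield K)) u₀)
                (isInteger_algebraMap (u₀ : v.adicCompletionIntegers (maximalRealSubfield K)))
                (isInteger_algebraMap_unit_inv u₀) hϖ' hs' k (α * ((Ideal.absNorm v.asIdeal : k) ^ 2)⁻¹))))) :=
  haveI := isCyclic_gal K h6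
  have hne : P ≠ ⊥ :=
    Ideal.ne_bot_of_liesOver_of_ne_bot
      ((Ideal.span_singleton_eq_bot).not.mpr (Nat.cast_ne_zero.mpr hp.out.ne_zero) : Ideal.span {(p : ℤ)} ≠ ⊥) P
  have he : P.ramificationIdx ℤ = 1 := hunr ⟨P, inferInstance, hne⟩ (natCast_mem_of_liesOver K p P)
  ((exists_map_eq_iff_even_inertiaDeg K p P v he).mpr hEven).elim fun w hmap =>
    ⟨w, hmap, @joint_outside_discriminant_of_staysPrime K _ _ _ (vRat p) v
      (liesOver_vRat_of_mem p v (natCast_mem_of_liesOver_of_liesOver K p P v))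
      (@discr_notMem_of_forall_ramificationIdx_eq_one K _ _ p _ hunr v
        (liesOver_int_of_mem p v (natCast_mem_of_liesOver_of_liesOver K p P v)))
      w (liesOver_of_map_eq K v w hmap) hmap k _ _ _⟩

end Summit.Ventures.HodgeRepro2.T5RecordJointCyclicGaloisCM
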